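import Summits.QuantumFields.YangMills.Theorems.BalabanLadderUVSeamRecResponseMomentsDefs
import Summits.QuantumFields.YangMills.Theorems.BalabanLadderNTBoundaryLawReferenceValue
import HarnessLib

/-!
# Crux `UVSeamRec` (stmt-QuantumFields-20043), v5(α) stub `stub_responseMomentsOdd6` (RM): the response-moment binder
# PINS its reference values — torus-DLR necessary conditions, the finite-size content, and the two recentring conversions

Helper file (`--supports stmt-QuantumFields-20043`) of the stub-helper seat `ym-20043-seam-s2` (lane S-A, gen 2).  The slot of
record v5(α) (`Cruxes/UVSeamRec`, sha afcf556d5b76a240) has ONE open measure-side stub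
`stub_responseMomentsOdd6 : UV → (RM)`, (RM) = `ResponseMomentsDefs.ResponseMomentsOdd6SU2` = the hypothesis of the landed
press-button `TemperedResponse.stubCeilings_of_responseMoments` (p532738): β-uniform joint exponential moments
`⟨exp(Σ_{i∈T} (R⁴/C₁)|kerE_{cube i}(plane_i) − p (q i) β|)⟩_{2L+1,β} ≤ exp(B·#T)` about reference values `p q β` that
depend on the orientation and the coupling ONLY — not on the torus side `2L+1`, not on the radius `R`.

This file records what that choice of currency entails, kernel-checked, for general `(G, r, a)`:

* §0 toolkit: integrals through the periodic lift; the ONE-SITE moment bound `⟨|k − p|⟩ ≤ (e^B − 1)/λ` from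
  `⟨exp(λ|k − p|)⟩ ≤ e^B` (`y + 1 ≤ eʸ`, no Jensen needed); the torus DLR identity for the radius-`R+1` response kernel
  `⟨plane q x⟩_{2L+1,β} = ⟨kerE_{x−(R+1), 2R+3}(plane q x)⟩_{2L+1,β}` (`torusE_plane_eq_torusE_kerE`, from the tree's
  `StubLower.torusE_eq_torusE_kerE`).
* §1 **`abs_torusE_plane_sub_le_of_responseMoments`** — (RM) ⇒ for `β ≥ β₁`, `1 ≤ R`, `R·a β ≤ ℓ₁`, `4R+8 ≤ L`, `q.1 < q.2`:
  `|⟨plane q x⟩_{2L+1,β} − p q β| ≤ C₁ (e^B − 1)/R⁴`.  The reference values of (RM) are NOT free: they are the torus plaquette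
  means up to `O(R⁻⁴)`, on EVERY admissible odd torus simultaneously (the (RM) analogue of the NT line's
  `BoundaryLaw.fbl6_pins_torusMean` for the ∀-exterior law).
* §2 **`abs_torusE_plane_sub_torusE_plane_le_of_responseMoments`** — the FINITE-SIZE content: two admissible odd tori
  (`4R+8 ≤ L, L'`) have plaquette means within `2 C₁ (e^B − 1)/R⁴`; with `R ≍ ℓ₁/a(β)` this says the plaquette mean depends
  on the (large, odd) torus side only at order `(a β/ℓ₁)⁴` — a NECESSARY condition of the registered stub, stated so the
  disprover / the NUMBER desk can test it;  **`torusE_abs_kerE_sub_torusE_le_of_responseMoments`** — the AVERAGED one-point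
  law `⟨|kerE(plane) − ⟨plane⟩|⟩_{2L+1,β} ≤ 2 C₁ (e^B − 1)/R⁴` (what (RM) says at ONE site: typical response `O(R⁻⁴)`).
* §3 the same read on the NAMED binder: `responseMomentsOdd6SU2_pins_torusMean`.
* Sequel `…ResponseMomentsRecentring.lean`: the two RECENTRING CONVERSIONS ((RM)[`p`] ⇒ (RM) centred at the torus means,
  `B ↦ B + e^B − 1`; centred + pinning `|⟨plane⟩ − p| ≤ D/R⁴` ⇒ (RM)[`p`], `B ↦ B + D/C₁`), so that an engine may deliver
  «typical response» and «finite-size insensitivity of the plaquette mean» separately.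

HONEST FRAMING: consumption-side necessary conditions and glue for ONE binder of a CONDITIONAL chain; (RM) at `β → ∞` is an
OPEN renormalisation-group statement (E0′-K with background); nothing of it and nothing of E0′ is proved here; not a gap,
not Clay.

References: H.-O. Georgii, *Gibbs Measures and Phase Transitions*, 2nd ed. (2011), Thm. 4.17 (DLR consistency — the tree's
`torusE_eq_torusE_kerE`); the elementary inequality `1 + y ≤ eʸ`.
-/

set_option autoImplicit false

noncomputable section

open MeasureTheory Filter Topology Finset
open Literature.MathematicalPhysics.QuantumFieldTheory (GaugeConfig wilsonMeasure isProbabilityMeasure_wilsonMeasure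
  LatticeRep)
open Literature.MathematicalPhysics.QuantumLattice
open Literature.Probability.LatticeModels
open Summit.QuantumFields.YangMills.Cruxes.OSLegsFromFemtoAndGap.DlrCollarTransfer
open Summit.QuantumFields.YangMills.Cruxes.OSLegsFromFemtoAndGap.DlrCollarTransfer.StubLower (torusE_eq_torusE_kerE)
open Summit.QuantumFields.YangMills.Theorems.OSLegsFromFemtoAndGap.StubLower (integrable_of_continuous_compact)
open Summit.QuantumFields.YangMills.Cruxes.UVSeamRec.TemperedResponse (continuous_kerE_plane abs_kerE_plane_le)

namespace Summit.QuantumFields.YangMills.Cruxes.UVSeamRec.ResponsePinning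

variable {G : Type} [Group G] [TopologicalSpace G] [IsTopologicalGroup G] [CompactSpace G]
  [MeasurableSpace G] [BorelSpace G] (r : LatticeRep G)

/-! ## §0 Toolkit: lifted integrals, the one-site moment bound, torus DLR for the response kernel -/

section Toolkit

/-- A continuous observable read through the periodic lift is integrable for the Wilson measure of the odd torus
(compact configuration space, probability measure). [folklore] -/
theorem integrable_comp_lift (β : ℝ) (L : ℕ) {F : LGConfig 4 G → ℝ} (hF : Continuous F) :
    Integrable (fun U : GaugeConfig 4 (2 * L + 1) G => F (torusLift (2 * L + 1) U))
      (wilsonMeasure (d := 4) (L := 2 * L + 1) r.ρ β) := by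
  haveI := r.secondCountableTopology
  haveI := isProbabilityMeasure_wilsonMeasure (d := 4) (L := 2 * L + 1) r.ρ r.continuous β
  exact integrable_of_continuous_compact (hF.comp (continuous_torusLift _))

/-- Monotonicity of the torus expectation on continuous observables. [folklore] -/
theorem torusE_mono (β : ℝ) (L : ℕ) {A B : LGConfig 4 G → ℝ} (hA : Continuous A) (hB : Continuous B)
    (hle : ∀ U, A U ≤ B U) : torusE G r β L A ≤ torusE G r β L B := by
  unfold torusE
  exact integral_mono (integrable_comp_lift r β L hA) (integrable_comp_lift r β L hB) fun U => hle _

/-- The torus expectation of a constant. [folklore] -/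
theorem torusE_const (β : ℝ) (L : ℕ) (c : ℝ) : torusE G r β L (fun _ => c) = c := by
  haveI := r.secondCountableTopology
  haveI := isProbabilityMeasure_wilsonMeasure (d := 4) (L := 2 * L + 1) r.ρ r.continuous β
  unfold torusE
  rw [integral_const, smul_eq_mul, probReal_univ, one_mul]

/-- Additivity of the torus expectation on continuous observables. [folklore] -/
theorem torusE_add' (β : ℝ) (L : ℕ) {A B : LGConfig 4 G → ℝ} (hA : Continuous A) (hB : Continuous B) :
    torusE G r β L (fun U => A U + B U) = torusE G r β L A + torusE G r β L B := by
  unfold torusE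
  exact integral_add (integrable_comp_lift r β L hA) (integrable_comp_lift r β L hB)

/-- Homogeneity of the torus expectation. [folklore] -/
theorem torusE_const_mul' (β : ℝ) (L : ℕ) (k : ℝ) (A : LGConfig 4 G → ℝ) :
    torusE G r β L (fun U => k * A U) = k * torusE G r β L A := by
  unfold torusE
  exact integral_const_mul k _

/-- The torus expectation of `U ↦ |A U − torusE A|`-type integrands: a value of a continuous observable is within the
oscillation of its mean — `|torusE A − c| ≤ h` whenever `|A U − c| ≤ h` for all `U`. [folklore] -/
theorem abs_torusE_sub_le_of_forall (β : ℝ) (L : ℕ) {A : LGConfig 4 G → ℝ} (hA : Continuous A) {c h : ℝ}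
    (hle : ∀ U, |A U - c| ≤ h) : |torusE G r β L A - c| ≤ h := by
  have h1 : torusE G r β L A - c = torusE G r β L (fun U => A U - c) := by
    rw [show (fun U => A U - c) = (fun U => A U + -c) from funext fun _ => sub_eq_add_neg _ _,
      torusE_add' r β L hA continuous_const, torusE_const]
    ring
  rw [h1]
  have hup : torusE G r β L (fun U => A U - c) ≤ h := by
    calc torusE G r β L (fun U => A U - c) ≤ torusE G r β L (fun _ => h) :=
          torusE_mono r β L (hA.sub continuous_const) continuous_const fun U => (le_abs_self _).trans (hle U)
      _ = h := torusE_const r β L h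
  have hlo : -h ≤ torusE G r β L (fun U => A U - c) := by
    calc -h = torusE G r β L (fun _ => -h) := (torusE_const r β L (-h)).symm
      _ ≤ torusE G r β L (fun U => A U - c) :=
          torusE_mono r β L continuous_const (hA.sub continuous_const) fun U => (neg_abs_le _).trans' (by
            exact neg_le_neg (hle U))
  exact abs_le.2 ⟨hlo, hup⟩

/-- **The one-site moment bound.**  For a continuous observable `k`, `λ > 0` and constants `p`, `B`: if
`⟨exp(λ|k − p|)⟩_{2L+1,β} ≤ e^B` then `⟨|k − p|⟩_{2L+1,β} ≤ (e^B − 1)/λ` (pointwise `λ|k − p| + 1 ≤ exp(λ|k − p|)`).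
[folklore] -/
theorem torusE_abs_sub_le_of_expMoment (β : ℝ) (L : ℕ) {k : LGConfig 4 G → ℝ} (hk : Continuous k) {lam : ℝ}
    (hlam : 0 < lam) {p B : ℝ}
    (h : torusE G r β L (fun U => Real.exp (lam * |k U - p|)) ≤ Real.exp B) :
    torusE G r β L (fun U => |k U - p|) ≤ (Real.exp B - 1) / lam := by
  have hc1 : Continuous fun U => |k U - p| := (hk.sub continuous_const).abs
  have hc2 : Continuous fun U => lam * |k U - p| := continuous_const.mul hc1
  have hc3 : Continuous fun U => Real.exp (lam * |k U - p|) := Real.continuous_exp.comp hc2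
  have key : torusE G r β L (fun U => lam * |k U - p| + 1) ≤ Real.exp B :=
    (torusE_mono r β L (hc2.add continuous_const) hc3 fun U => Real.add_one_le_exp _).trans h
  rw [torusE_add' r β L hc2 continuous_const, torusE_const, torusE_const_mul'] at key
  rw [le_div_iff₀ hlam]
  linarith

/-- The support window of the single-plane field at `x` inside the cube of radius `R+1` around `x`. [folklore] -/
theorem plane_window_succ (q : Fin 4 × Fin 4) (x : Fin 4 → ℤ) (R : ℕ) :
    ∀ e ∈ (originPlaquetteSupport q.1 q.2).image (fun e => (e.1 - -x, e.2)), ∀ j,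
      x j - ((R + 1 : ℕ) : ℤ) ≤ e.1 j ∧ e.1 j ≤ x j + ((R + 1 : ℕ) : ℤ) := fun e he j => by
  obtain ⟨h0, h1⟩ := near_of_mem_supp_plane he j
  push_cast
  constructor <;> omega

/-- **Torus DLR for the response kernel.**  On the odd torus `(ℤ/(2L+1))⁴` with `R + 2 ≤ L`, the torus mean of the
single-plane field equals the torus mean of its radius-`R+1` cube-kernel mean:
`⟨plane q x⟩_{2L+1,β} = ⟨kerE_{x−(R+1), 2R+3}(plane q x)⟩_{2L+1,β}`. [folklore: Georgii (2011) Thm. 4.17] -/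
theorem torusE_plane_eq_torusE_kerE (β : ℝ) (q : Fin 4 × Fin 4) (x : Fin 4 → ℤ) (R L : ℕ) (hRL : R + 2 ≤ L) :
    torusE G r β L (plane G r q x) =
      torusE G r β L (fun η => kerE G r β (fun k => x k - (R + 1)) (2 * R + 3) η (plane G r q x)) := by
  obtain ⟨C, hC⟩ := exists_abs_plane_le (G := G) r
  have h := torusE_eq_torusE_kerE G r β x (R + 1) L (by omega) (continuous_plane r q x) (hC q x)
    (isCylinder_plane r q x) (plane_window_succ q x R)
  have e1 : (fun j : Fin 4 => x j - ((R + 1 : ℕ) : ℤ)) = fun k => x k - (R + 1) := funext fun _ => by push_cast; ring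
  have e2 : 2 * (R + 1) + 1 = 2 * R + 3 := by ring
  rw [e1, e2] at h
  exact h

end Toolkit

/-! ## §1 (RM) pins the reference values to the torus plaquette means -/

section Pinning

variable (a : ℝ → ℝ)

/-- **(RM) pins its reference values.**  Under the response-moment hypothesis (RM) at unit `a` (reference values `p`,
constants `C₁ > 0`, `B`, `β₁`, `ℓ₁` — the `hRM` of p532025 `momentBounds6_of_responseMoments` VERBATIM): for `β ≥ β₁`, on
every odd torus `(ℤ/(2L+1))⁴` and every radius `R` with `1 ≤ R`, `R·a β ≤ ℓ₁`, `4R+8 ≤ L`, every orientation `q.1 < q.2`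
and site `x`, `|⟨plane q x⟩_{2L+1,β} − p q β| ≤ C₁ (e^B − 1)/R⁴`.  Proof: (RM) at the one-member family (`n = 1`,
`T = {0}`) is `⟨exp((R⁴/C₁)|kerE − p|)⟩ ≤ e^B`; the one-site moment bound gives `⟨|kerE − p|⟩ ≤ C₁(e^B − 1)/R⁴`; torus
DLR `⟨kerE(plane)⟩ = ⟨plane⟩`. [folklore: Georgii (2011) Thm. 4.17] -/
theorem abs_torusE_plane_sub_le_of_responseMoments {C₁ B β₁ ℓ₁ : ℝ} {p : Fin 4 × Fin 4 → ℝ → ℝ} (hC₁ : 0 < C₁)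
    (hRM : ∀ β : ℝ, β₁ ≤ β → ∀ (L n : ℕ) (q : Fin n → Fin 4 × Fin 4) (x : Fin n → (Fin 4 → ℤ)) (R : ℕ),
      (∀ i, (q i).1 < (q i).2) → 1 ≤ R → (R : ℝ) * a β ≤ ℓ₁ → 4 * R + 8 ≤ L →
      (∀ i j : Fin n, i ≠ j → ∃ k : Fin 4,
        (2 * (R : ℤ) + 4) ≤ |((((x i k - x j k : ℤ) : ZMod (2 * L + 1))).valMinAbs : ℤ)|) →
      ∀ T : Finset (Fin n),
        torusE G r β L (fun U => Real.exp (∑ i ∈ T, (R : ℝ) ^ 4 / C₁ *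
          |kerE G r β (fun k => x i k - (R + 1)) (2 * R + 3) U (plane G r (q i) (x i)) - p (q i) β|)) ≤
          Real.exp (B * T.card))
    {β : ℝ} (hβ : β₁ ≤ β) {L R : ℕ} (q : Fin 4 × Fin 4) (x : Fin 4 → ℤ) (hq : q.1 < q.2) (hR : 1 ≤ R)
    (hRa : (R : ℝ) * a β ≤ ℓ₁) (hRL : 4 * R + 8 ≤ L) :
    |torusE G r β L (plane G r q x) - p q β| ≤ C₁ * (Real.exp B - 1) / (R : ℝ) ^ 4 := by
  -- (RM) at the one-member family
  have h1 := hRM β hβ L 1 (fun _ => q) (fun _ => x) R (fun _ => hq) hR hRa hRL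
    (fun i j hij => absurd (Subsingleton.elim i j) hij) Finset.univ
  simp only [Finset.univ_unique, Finset.sum_singleton, Finset.card_singleton, Nat.cast_one, mul_one] at h1
  set k : LGConfig 4 G → ℝ := fun U => kerE G r β (fun k => x k - (R + 1)) (2 * R + 3) U (plane G r q x) with hk
  have hkc : Continuous k := continuous_kerE_plane r β _ _ q x
  have hR0 : (0 : ℝ) < R := by exact_mod_cast (show 0 < R by omega)
  have hlam : 0 < (R : ℝ) ^ 4 / C₁ := by positivity
  have h2 : torusE G r β L (fun U => |k U - p q β|) ≤ (Real.exp B - 1) / ((R : ℝ) ^ 4 / C₁) :=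
    torusE_abs_sub_le_of_expMoment r β L hkc hlam (p := p q β) (B := B) h1
  have h3 : (Real.exp B - 1) / ((R : ℝ) ^ 4 / C₁) = C₁ * (Real.exp B - 1) / (R : ℝ) ^ 4 := by
    field_simp
  rw [h3] at h2
  -- torus DLR and `|∫f| ≤ ∫|f|`
  rw [torusE_plane_eq_torusE_kerE r β q x R L (by omega)]
  have h4 : torusE G r β L k - p q β = torusE G r β L (fun U => k U - p q β) := by
    rw [show (fun U => k U - p q β) = (fun U => k U + -p q β) from funext fun _ => sub_eq_add_neg _ _,
      torusE_add' r β L hkc continuous_const, torusE_const]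
    ring
  change |torusE G r β L k - p q β| ≤ _
  rw [h4]
  unfold torusE at h2 ⊢
  exact (abs_integral_le_integral_abs).trans h2

end Pinning

/-! ## §2 The finite-size content and the averaged one-point law -/

section FiniteSize

variable (a : ℝ → ℝ)

/-- **Finite-size pinning — a necessary condition of (RM).**  Under (RM), for `β ≥ β₁`, `1 ≤ R`, `R·a β ≤ ℓ₁` and any two
odd tori with `4R+8 ≤ L`, `4R+8 ≤ L'`, the plaquette means (any orientation `q.1 < q.2`, any sites) satisfy
`|⟨plane q x⟩_{2L+1,β} − ⟨plane q x'⟩_{2L'+1,β}| ≤ 2 C₁ (e^B − 1)/R⁴`.  With `R = ⌊ℓ₁/a β⌋` this is `O((a β/ℓ₁)⁴)`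
uniformly in the two sides: the registered stub asserts, in particular, that the Wilson plaquette mean on large odd tori
is insensitive to the torus side at the fourth order of the unit. [folklore] -/
theorem abs_torusE_plane_sub_torusE_plane_le_of_responseMoments {C₁ B β₁ ℓ₁ : ℝ} {p : Fin 4 × Fin 4 → ℝ → ℝ}
    (hC₁ : 0 < C₁)
    (hRM : ∀ β : ℝ, β₁ ≤ β → ∀ (L n : ℕ) (q : Fin n → Fin 4 × Fin 4) (x : Fin n → (Fin 4 → ℤ)) (R : ℕ),
      (∀ i, (q i).1 < (q i).2) → 1 ≤ R → (R : ℝ) * a β ≤ ℓ₁ → 4 * R + 8 ≤ L →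
      (∀ i j : Fin n, i ≠ j → ∃ k : Fin 4,
        (2 * (R : ℤ) + 4) ≤ |((((x i k - x j k : ℤ) : ZMod (2 * L + 1))).valMinAbs : ℤ)|) →
      ∀ T : Finset (Fin n),
        torusE G r β L (fun U => Real.exp (∑ i ∈ T, (R : ℝ) ^ 4 / C₁ *
          |kerE G r β (fun k => x i k - (R + 1)) (2 * R + 3) U (plane G r (q i) (x i)) - p (q i) β|)) ≤
          Real.exp (B * T.card))
    {β : ℝ} (hβ : β₁ ≤ β) {L L' R : ℕ} (q : Fin 4 × Fin 4) (x x' : Fin 4 → ℤ) (hq : q.1 < q.2) (hR : 1 ≤ R)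
    (hRa : (R : ℝ) * a β ≤ ℓ₁) (hRL : 4 * R + 8 ≤ L) (hRL' : 4 * R + 8 ≤ L') :
    |torusE G r β L (plane G r q x) - torusE G r β L' (plane G r q x')| ≤
      2 * (C₁ * (Real.exp B - 1) / (R : ℝ) ^ 4) := by
  have h1 := abs_torusE_plane_sub_le_of_responseMoments r a hC₁ hRM hβ q x hq hR hRa hRL
  have h2 := abs_torusE_plane_sub_le_of_responseMoments r a hC₁ hRM hβ q x' hq hR hRa hRL'
  calc |torusE G r β L (plane G r q x) - torusE G r β L' (plane G r q x')|
      = |(torusE G r β L (plane G r q x) - p q β) - (torusE G r β L' (plane G r q x') - p q β)| := by ring_nf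
    _ ≤ |torusE G r β L (plane G r q x) - p q β| + |torusE G r β L' (plane G r q x') - p q β| := abs_sub _ _
    _ ≤ _ := by linarith

/-- **The averaged one-point law — what (RM) says at one site.**  Under (RM), for `β ≥ β₁`, `1 ≤ R`, `R·a β ≤ ℓ₁`,
`4R+8 ≤ L`, `q.1 < q.2`: the MEAN absolute response of the radius-`R+1` cube kernel about the torus mean is
`⟨|kerE_{x−(R+1),2R+3}(plane q x) − ⟨plane q x⟩_{2L+1,β}|⟩_{2L+1,β} ≤ 2 C₁ (e^B − 1)/R⁴` — typical exteriors respond at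
`O(R⁻⁴)` (no claim about EVERY exterior). [folklore] -/
theorem torusE_abs_kerE_sub_torusE_le_of_responseMoments {C₁ B β₁ ℓ₁ : ℝ} {p : Fin 4 × Fin 4 → ℝ → ℝ}
    (hC₁ : 0 < C₁)
    (hRM : ∀ β : ℝ, β₁ ≤ β → ∀ (L n : ℕ) (q : Fin n → Fin 4 × Fin 4) (x : Fin n → (Fin 4 → ℤ)) (R : ℕ),
      (∀ i, (q i).1 < (q i).2) → 1 ≤ R → (R : ℝ) * a β ≤ ℓ₁ → 4 * R + 8 ≤ L →
      (∀ i j : Fin n, i ≠ j → ∃ k : Fin 4,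
        (2 * (R : ℤ) + 4) ≤ |((((x i k - x j k : ℤ) : ZMod (2 * L + 1))).valMinAbs : ℤ)|) →
      ∀ T : Finset (Fin n),
        torusE G r β L (fun U => Real.exp (∑ i ∈ T, (R : ℝ) ^ 4 / C₁ *
          |kerE G r β (fun k => x i k - (R + 1)) (2 * R + 3) U (plane G r (q i) (x i)) - p (q i) β|)) ≤
          Real.exp (B * T.card))
    {β : ℝ} (hβ : β₁ ≤ β) {L R : ℕ} (q : Fin 4 × Fin 4) (x : Fin 4 → ℤ) (hq : q.1 < q.2) (hR : 1 ≤ R)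
    (hRa : (R : ℝ) * a β ≤ ℓ₁) (hRL : 4 * R + 8 ≤ L) :
    torusE G r β L (fun U => |kerE G r β (fun k => x k - (R + 1)) (2 * R + 3) U (plane G r q x) -
        torusE G r β L (plane G r q x)|) ≤ 2 * (C₁ * (Real.exp B - 1) / (R : ℝ) ^ 4) := by
  -- the one-site moment bound about `p`, and the pinning of the mean to `p`
  have h1 := hRM β hβ L 1 (fun _ => q) (fun _ => x) R (fun _ => hq) hR hRa hRL
    (fun i j hij => absurd (Subsingleton.elim i j) hij) Finset.univ
  simp only [Finset.univ_unique, Finset.sum_singleton, Finset.card_singleton, Nat.cast_one, mul_one] at h1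
  set k : LGConfig 4 G → ℝ := fun U => kerE G r β (fun k => x k - (R + 1)) (2 * R + 3) U (plane G r q x) with hk
  have hkc : Continuous k := continuous_kerE_plane r β _ _ q x
  have hR0 : (0 : ℝ) < R := by exact_mod_cast (show 0 < R by omega)
  have hlam : 0 < (R : ℝ) ^ 4 / C₁ := by positivity
  have h2 : torusE G r β L (fun U => |k U - p q β|) ≤ (Real.exp B - 1) / ((R : ℝ) ^ 4 / C₁) :=
    torusE_abs_sub_le_of_expMoment r β L hkc hlam (p := p q β) (B := B) h1
  have h3 : (Real.exp B - 1) / ((R : ℝ) ^ 4 / C₁) = C₁ * (Real.exp B - 1) / (R : ℝ) ^ 4 := by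
    field_simp
  rw [h3] at h2
  have hpin := abs_torusE_plane_sub_le_of_responseMoments r a hC₁ hRM hβ q x hq hR hRa hRL
  set m := torusE G r β L (plane G r q x) with hm
  have hpm : |p q β - m| ≤ C₁ * (Real.exp B - 1) / (R : ℝ) ^ 4 := by rw [abs_sub_comm]; exact hpin
  -- pointwise triangle inequality, then integrate
  have hpt : ∀ U, |k U - m| ≤ |k U - p q β| + C₁ * (Real.exp B - 1) / (R : ℝ) ^ 4 := fun U => by
    calc |k U - m| = |(k U - p q β) + (p q β - m)| := by ring_nf
      _ ≤ |k U - p q β| + |p q β - m| := abs_add_le _ _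
      _ ≤ |k U - p q β| + C₁ * (Real.exp B - 1) / (R : ℝ) ^ 4 := by linarith [hpm]
  calc torusE G r β L (fun U => |k U - m|)
      ≤ torusE G r β L (fun U => |k U - p q β| + C₁ * (Real.exp B - 1) / (R : ℝ) ^ 4) :=
        torusE_mono r β L (hkc.sub continuous_const).abs ((hkc.sub continuous_const).abs.add continuous_const) hpt
    _ = torusE G r β L (fun U => |k U - p q β|) + C₁ * (Real.exp B - 1) / (R : ℝ) ^ 4 := by
        rw [torusE_add' r β L (A := fun U => |k U - p q β|) (B := fun _ => C₁ * (Real.exp B - 1) / (R : ℝ) ^ 4)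
          (hkc.sub continuous_const).abs continuous_const, torusE_const]
    _ ≤ 2 * (C₁ * (Real.exp B - 1) / (R : ℝ) ^ 4) := by linarith

end FiniteSize

/-! ## §3 The named binder of record pins the torus plaquette means of `SU(2)` -/

section Named

open Summit.QuantumFields.YangMills.Cruxes.UVSeamRec.ResponseMomentsDefs (ResponseMomentsOdd6SU2)

/-- **The registered (RM) pins the `SU(2)` plaquette means.**  `ResponseMomentsOdd6SU2` (the conclusion of the v5(α) stub
`stub_responseMomentsOdd6`, p536324) yields a unit `a ≤ c·uRec` eventually, `C₁ > 0`, `B`, `β₁`, `ℓ₁ > 0` and BOUNDED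
reference values `p` such that on every admissible odd torus the fundamental-representation plaquette mean is within
`C₁(e^B − 1)/R⁴` of `p q β`, and any two admissible odd tori have plaquette means within `2C₁(e^B − 1)/R⁴` of each other
(`1 ≤ R`, `R·a β ≤ ℓ₁`, `4R+8 ≤ L, L'`, `β ≥ β₁`). [folklore] -/
theorem responseMomentsOdd6SU2_pins_torusMean (h : ResponseMomentsOdd6SU2) :
    letI : MeasurableSpace (Matrix.specialUnitaryGroup (Fin 2) ℂ) := borel _
    haveI : BorelSpace (Matrix.specialUnitaryGroup (Fin 2) ℂ) := ⟨rfl⟩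
    ∃ (a : ℝ → ℝ) (c : ℝ) (C₁ B β₁ ℓ₁ P₀ : ℝ) (p : Fin 4 × Fin 4 → ℝ → ℝ), 0 < c ∧
      (∀ᶠ β in atTop, a β ≤ c * Transport.uRec β) ∧ 0 < ℓ₁ ∧ 0 < C₁ ∧ (∀ q β, |p q β| ≤ P₀) ∧
      (∀ β : ℝ, β₁ ≤ β → ∀ (L : ℕ) (q : Fin 4 × Fin 4) (x : Fin 4 → ℤ) (R : ℕ), q.1 < q.2 → 1 ≤ R →
        (R : ℝ) * a β ≤ ℓ₁ → 4 * R + 8 ≤ L →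
        |torusE (Matrix.specialUnitaryGroup (Fin 2) ℂ) (fundamentalLatticeRep 2) β L
            (plane (Matrix.specialUnitaryGroup (Fin 2) ℂ) (fundamentalLatticeRep 2) q x) - p q β| ≤
          C₁ * (Real.exp B - 1) / (R : ℝ) ^ 4) ∧
      (∀ β : ℝ, β₁ ≤ β → ∀ (L L' : ℕ) (q : Fin 4 × Fin 4) (x x' : Fin 4 → ℤ) (R : ℕ), q.1 < q.2 → 1 ≤ R →
        (R : ℝ) * a β ≤ ℓ₁ → 4 * R + 8 ≤ L → 4 * R + 8 ≤ L' →
        |torusE (Matrix.specialUnitaryGroup (Fin 2) ℂ) (fundamentalLatticeRep 2) β L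
            (plane (Matrix.specialUnitaryGroup (Fin 2) ℂ) (fundamentalLatticeRep 2) q x) -
          torusE (Matrix.specialUnitaryGroup (Fin 2) ℂ) (fundamentalLatticeRep 2) β L'
            (plane (Matrix.specialUnitaryGroup (Fin 2) ℂ) (fundamentalLatticeRep 2) q x')| ≤
          2 * (C₁ * (Real.exp B - 1) / (R : ℝ) ^ 4)) := by
  letI : MeasurableSpace (Matrix.specialUnitaryGroup (Fin 2) ℂ) := borel _
  haveI : BorelSpace (Matrix.specialUnitaryGroup (Fin 2) ℂ) := ⟨rfl⟩
  obtain ⟨a, c, C₁, B, β₁, ℓ₁, P₀, p, hc, hle, hℓ₁, hC₁, hp, hRM⟩ := h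
  refine ⟨a, c, C₁, B, β₁, ℓ₁, P₀, p, hc, hle, hℓ₁, hC₁, hp, ?_, ?_⟩
  · intro β hβ L q x R hq hR hRa hRL
    exact abs_torusE_plane_sub_le_of_responseMoments (fundamentalLatticeRep 2) a hC₁ hRM hβ q x hq hR hRa hRL
  · intro β hβ L L' q x x' R hq hR hRa hRL hRL'
    exact abs_torusE_plane_sub_torusE_plane_le_of_responseMoments (fundamentalLatticeRep 2) a hC₁ hRM hβ q x x'
      hq hR hRa hRL hRL'

end Named

end Summit.QuantumFields.YangMills.Cruxes.UVSeamRec.ResponsePinning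

end
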